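import Summits.Ventures.Crystal3D.Theorems.StickyWulffConstantNoReconstructionGainExactFilmAboveCutAll
import Summits.Ventures.Crystal3D.Theorems.StickyWulffConstantNoReconstructionGainExactThinNoCriminal
import Literature.Geometry.DiscreteGeometry.KerteszNinePointsHemisphereHolds
import Literature.Geometry.DiscreteGeometry.KerteszAzimuthArcs
import Literature.Geometry.DiscreteGeometry.SphericalCodeContactGraph
import Mathlib.Analysis.SpecialFunctions.Complex.Arg
import HarnessLib

/-!
# Criminal anatomy after Kertész: the top ball of a criminal has SEVEN OR EIGHT partners
# (crux `NoReconstructionGain`, stmt-Ventures-19144, line `replication-exactness`, inside `stub_noCriminal`)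

HONEST FRAMING. Part of the venture `Summits/Ventures/Crystal3D` (cell `crystal3d-full`), helper `--supports` the
crux `NoReconstructionGain` (stmt-Ventures-19144, route `route-Ventures-StickyWulffConstant`), lead wulff-p1 g24.
ANATOMY of a hypothetical criminal (a structural constraint any refuter/prover of `stub_noCriminal` may use); no
film class is settled here and the crux is not moved.

The registered anatomy (`exists_top_window_of_criminal`, skeleton v6 docstring) says: the `ν`-highest ball of a
criminal has between `7` and `9` partners (plugs and film balls at distance `1`), all in the closed lower half-space,
the `9` coming from G. Fejes Tóth's one-sided kissing number `B(3) = 9`.  With Kertész's nine-point theorem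
(`kertesz1994_ninePointsHemisphere_holds`, on the standard axioms since p751552) the `9` is excluded for a
well-chosen top ball:

* `exists_top_le_eight_of_criminal` — **every criminal (any face `ν`, any cut) has a `ν`-highest ball with
  exactly `7` or `8` partners.**  Choose, among the balls of maximal `ν`-height, one that is extreme in a fixed
  horizontal direction `e₁` (minimal `⟪·, e₁⟫`).  If it had `9` partners, Kertész puts six of them ON its equator;
  level partners are film balls (plugs lie strictly `ν`-below, `plug_below`) of maximal height, so by the choice of
  the ball they all satisfy `⟪y − q, e₁⟫ ≥ 0`: six unit vectors of the plane `ν^⊥`, pairwise `≥ 60°` apart, in a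
  closed half-plane — but a half-plane holds at most four (`arc_lower_bound`: five gaps of `π/3` exceed `π`).

WHAT THIS IS NOT: no statement about balls other than the chosen top ball (other top-height balls may have nine
partners); not a film theorem; rung F-C1 not moved.
-/

noncomputable section

namespace Summit.Ventures.Crystal3D.Theorems

open Finset Real
open Literature.MathematicalPhysics.StatisticalMechanics (fccStacking)
open scoped InnerProductSpace

open scoped Classical in
/-- **The top ball of a criminal has seven or eight partners.**  Every criminal `Q` on `H(ν, s)` has a ball `q`
of maximal `ν`-height whose partners (substrate plugs and film balls at distance `1`) number `7` or `8` — never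
`9`: Kertész's theorem would put six level partners around an `e₁`-extreme top ball, and six `60°`-separated unit
vectors do not fit in a closed half-plane. -/
theorem exists_top_le_eight_of_criminal {ν : EuclideanSpace ℝ (Fin 3)} (hν : ‖ν‖ = 1) {s : ℝ}
    {Q : Finset (EuclideanSpace ℝ (Fin 3))} (hQ : IsCriminal ν s Q) :
    ∃ q ∈ Q, (∀ y ∈ Q, ⟪y, ν⟫_ℝ ≤ ⟪q, ν⟫_ℝ) ∧
      7 ≤ (plugSet ν s q).ncard + (Q.filter fun y => dist q y = 1).card ∧
      (plugSet ν s q).ncard + (Q.filter fun y => dist q y = 1).card ≤ 8 := by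
  -- an orthonormal frame `b` with `b 2 = ν`; `e₁ := b 0`
  obtain ⟨b, hb2⟩ := Literature.Geometry.DiscreteGeometry.exists_orthonormalBasis_third_eq_unit hν
  -- the balls of maximal height, and among them one of minimal `⟪·, b 0⟫`
  set M := Q.filter (fun y => ∀ y' ∈ Q, ⟪y', ν⟫_ℝ ≤ ⟪y, ν⟫_ℝ) with hM
  obtain ⟨q₀, hq₀, hq₀max⟩ := Finset.exists_max_image Q (fun y => ⟪y, ν⟫_ℝ) hQ.2.1
  have hMne : M.Nonempty := ⟨q₀, by rw [hM, mem_filter]; exact ⟨hq₀, hq₀max⟩⟩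
  obtain ⟨q, hqM, hqmin⟩ := Finset.exists_min_image M (fun y => ⟪y, b 0⟫_ℝ) hMne
  have hq : q ∈ Q := (mem_filter.1 hqM).1
  have hmax : ∀ y ∈ Q, ⟪y, ν⟫_ℝ ≤ ⟪q, ν⟫_ℝ := (mem_filter.1 hqM).2
  refine ⟨q, hq, hmax, seven_le_plug_add_deg_of_criminal hQ hq, ?_⟩
  -- the partner set `T`
  have hfin := plugSet_finite ν s q
  set T := hfin.toFinset ∪ Q.filter fun y => dist q y = 1 with hTdef
  have hdisj : Disjoint hfin.toFinset (Q.filter fun y => dist q y = 1) := by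
    rw [Finset.disjoint_left]
    intro y hy hy'
    rw [Set.Finite.mem_toFinset] at hy
    rw [Finset.mem_filter] at hy'
    have := hQ.1.2 y hy'.1 y hy.1
    rw [dist_self] at this; linarith
  have hTcard : T.card = (plugSet ν s q).ncard + (Q.filter fun y => dist q y = 1).card := by
    rw [hTdef, Finset.card_union_of_disjoint hdisj, Set.ncard_eq_toFinset_card _ hfin]
  have hT : ∀ x ∈ T, (x ∈ plugSet ν s q ∨ x ∈ Q) ∧ dist q x = 1 := by
    intro x hx
    rw [hTdef, Finset.mem_union, Set.Finite.mem_toFinset, Finset.mem_filter] at hx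
    rcases hx with hx | hx
    · exact ⟨Or.inl hx, hx.2⟩
    · exact ⟨Or.inr hx.1, hx.2⟩
  -- level partners are film balls of maximal height, hence `⟪x − q, b 0⟫ ≥ 0`
  have hlevel : ∀ x ∈ T, ⟪ν, x - q⟫_ℝ = 0 → 0 ≤ ⟪b 0, x - q⟫_ℝ := by
    intro x hx h0
    rw [hTdef, Finset.mem_union, Set.Finite.mem_toFinset, Finset.mem_filter] at hx
    rcases hx with hx | hx
    · -- a plug is strictly below
      have := plug_below hν hQ.1 hq hx
      rw [inner_sub_right, real_inner_comm x ν, real_inner_comm q ν] at h0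
      linarith
    · have hxM : x ∈ M := by
        rw [hM, mem_filter]
        refine ⟨hx.1, fun y' hy' => ?_⟩
        rw [inner_sub_right, real_inner_comm x ν, real_inner_comm q ν] at h0
        linarith [hmax y' hy']
      have := hqmin x hxM
      rw [inner_sub_right, real_inner_comm x (b 0), real_inner_comm q (b 0)]
      linarith
  -- the one-sided code on the unit sphere
  have hne : ‖-ν‖ = 1 := by rw [norm_neg, hν]
  have hhalf : ∀ x ∈ T, 0 ≤ ⟪-ν, x - q⟫_ℝ := by
    intro x hx
    rw [inner_neg_left, inner_sub_right, real_inner_comm q ν, real_inner_comm x ν]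
    rw [hTdef, Finset.mem_union, Set.Finite.mem_toFinset, Finset.mem_filter] at hx
    rcases hx with hx | hx
    · have := plug_below hν hQ.1 hq hx
      linarith
    · linarith [hmax x hx.1]
  have h9 := card_halfspace_partners_le_nine hQ.1 q hne T hT hhalf
  rw [← hTcard]
  by_contra h8
  have hT9 : T.card = 9 := by omega
  obtain ⟨hn, hsep, hVcard⟩ := halfspace_partners_code hQ.1 q T hT
  set V := T.image (fun x => x - q) with hV
  rw [hT9] at hVcard
  have hhemi : ∀ v ∈ V, 0 ≤ ⟪-ν, v⟫_ℝ := by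
    intro v hv
    obtain ⟨x, hx, rfl⟩ := Finset.mem_image.1 hv
    exact hhalf x hx
  have hK6 := Literature.Geometry.DiscreteGeometry.kertesz1994_ninePointsHemisphere_holds (-ν) hne V hn hhemi
    hsep hVcard
  set K := V.filter (fun v => ⟪-ν, v⟫_ℝ = 0) with hK
  -- every `v ∈ K` is a unit vector of the plane `ν^⊥` with `⟪b 0, v⟫ ≥ 0`
  have hKmem : ∀ v ∈ K, ‖v‖ = 1 ∧ ⟪b 2, v⟫_ℝ = 0 ∧ 0 ≤ ⟪b 0, v⟫_ℝ := by
    intro v hv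
    have hvV : v ∈ V := (mem_filter.1 hv).1
    have h0 : ⟪-ν, v⟫_ℝ = 0 := (mem_filter.1 hv).2
    rw [inner_neg_left, neg_eq_zero] at h0
    obtain ⟨x, hx, rfl⟩ := Finset.mem_image.1 hvV
    exact ⟨hn _ hvV, by rw [hb2]; exact h0, hlevel x hx h0⟩
  -- planar coordinates and angles
  set zc : EuclideanSpace ℝ (Fin 3) → ℂ := fun v => ⟨⟪b 0, v⟫_ℝ, ⟪b 1, v⟫_ℝ⟩ with hzc
  have hzn : ∀ v ∈ K, ‖zc v‖ = 1 := by
    intro v hv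
    obtain ⟨hv1, hv2, -⟩ := hKmem v hv
    have h1 : ⟪v, v⟫_ℝ = 1 := by rw [real_inner_self_eq_norm_sq, hv1]; norm_num
    rw [Literature.Geometry.DiscreteGeometry.inner_eq_sum_three b, hv2] at h1
    have h2 : ‖zc v‖ ^ 2 = 1 := by
      rw [Complex.sq_norm, hzc, Complex.normSq_mk]
      nlinarith [h1]
    nlinarith [norm_nonneg (zc v), h2]
  have hzne : ∀ v ∈ K, zc v ≠ 0 := by
    intro v hv h
    have := hzn v hv
    rw [h, norm_zero] at this
    norm_num at this
  -- pairwise: `cos (arg − arg') ≤ 1/2`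
  have hcos : ∀ v ∈ K, ∀ w ∈ K, v ≠ w → Real.cos (Complex.arg (zc v) - Complex.arg (zc w)) ≤ 1 / 2 := by
    intro v hv w hw hvw
    have hvV : v ∈ V := (mem_filter.1 hv).1
    have hwV : w ∈ V := (mem_filter.1 hw).1
    obtain ⟨hv1, hv2, -⟩ := hKmem v hv
    obtain ⟨hw1, hw2, -⟩ := hKmem w hw
    have hd := hsep v hvV w hwV hvw
    have hin : ⟪v, w⟫_ℝ ≤ 1 / 2 := by
      have h2 : dist v w ^ 2 = 2 - 2 * ⟪v, w⟫_ℝ := by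
        rw [dist_eq_norm, norm_sub_sq_real, hv1, hw1]; ring
      nlinarith [hd, h2, dist_nonneg (x := v) (y := w)]
    have hsum : ⟪v, w⟫_ℝ = (zc v).re * (zc w).re + (zc v).im * (zc w).im := by
      rw [Literature.Geometry.DiscreteGeometry.inner_eq_sum_three b, hv2, hzc]
      simp
    rw [hsum, re_mul_add_im_mul (zc v) (zc w) (hzne v hv) (hzne w hw), hzn v hv, hzn w hw] at hin
    linarith
  -- angles lie in `[−π/2, π/2]`
  have harg : ∀ v ∈ K, |Complex.arg (zc v)| ≤ π / 2 := by
    intro v hv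
    rw [Complex.abs_arg_le_pi_div_two_iff]
    exact (hKmem v hv).2.2
  -- the angle set
  set S := K.image (fun v => Complex.arg (zc v)) with hS
  have hSinj : Set.InjOn (fun v => Complex.arg (zc v)) K := by
    intro v hv w hw h
    by_contra hvw
    have := hcos v hv w hw hvw
    simp only at h
    rw [h, sub_self, Real.cos_zero] at this
    linarith
  have hScard : S.card = K.card := Finset.card_image_of_injOn hSinj
  have hSmem : ∀ t ∈ S, -(π / 2) ≤ t ∧ t ≤ π / 2 := by
    intro t ht
    obtain ⟨v, hv, rfl⟩ := Finset.mem_image.1 ht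
    exact abs_le.1 (harg v hv)
  have hSgap : ∀ t ∈ S, ∀ t' ∈ S, t < t' → π / 3 ≤ t' - t := by
    intro t ht t' ht' htt
    obtain ⟨v, hv, rfl⟩ := Finset.mem_image.1 ht
    obtain ⟨w, hw, rfl⟩ := Finset.mem_image.1 ht'
    have hvw : v ≠ w := fun h => by rw [h] at htt; exact lt_irrefl _ htt
    have hc := hcos w hw v hv (Ne.symm hvw)
    -- `0 ≤ x ≤ π` with `cos x ≤ 1/2 = cos (π/3)` gives `π/3 ≤ x`
    have hx0 : 0 ≤ Complex.arg (zc w) - Complex.arg (zc v) := by linarith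
    have hxπ : Complex.arg (zc w) - Complex.arg (zc v) ≤ π := by
      linarith [(hSmem _ ht).1, (hSmem _ ht').2]
    by_contra hlt
    push Not at hlt
    have := Real.cos_lt_cos_of_nonneg_of_le_pi_div_two hx0 (by linarith [pi_pos]) hlt
    rw [Real.cos_pi_div_three] at this
    linarith
  have hSne : S.Nonempty := by
    rw [← Finset.card_pos, hScard]; omega
  have hwalk := Literature.Geometry.DiscreteGeometry.arc_lower_bound (α := -(π / 2)) (β := π / 2)
    (Da := 0) (Db := 0) (G := π / 3) S hSne (fun t ht => by linarith [(hSmem t ht).1])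
    (fun t ht => by linarith [(hSmem t ht).2]) hSgap
  have hS6 : (6 : ℝ) ≤ S.card := by rw [hScard]; exact_mod_cast hK6
  nlinarith [hwalk, hS6, pi_pos]

end Summit.Ventures.Crystal3D.Theorems

end
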